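import Summits.ABC.IUTFork.Conditional.HvolSharpSplitDepth
import Summits.ABC.IUTFork.Conditional.AbcOfSHvolAdmissibleWindowContent
import Literature.NumberTheory.DiophantineGeometry.GenEllConductorHeight
import Literature.IUT.LogVolume.Corollary22PartIILemmas
import HarnessLib

/-!
# Branch C, TARGET #1: the admissible degree-2 family with its (P1)-WINDOW prime and the SHARP necessity of the (U)-line CONE
# binder there; the bookkeeping of the refutation (abc-iut-C-cert-1 gen 3, unit «HVOL-KERNEL», part 2a; part 2b = `Conditional/NotHvol.lean`)

Record-only PROOF file (D-0012) of the abc-iut cell; TAKES NO SIDE on [IUTchIII] Cor. 3.12, on [IUTchIV] Thm. 1.10, on the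
(U)/(P) readings of "`−|log(Θ)|`", or on any author. S. Mochizuki, *IUT IV* [Mochizuki2012], Thm. 1.10 proof Step (ii) p. 24,
Step (v) pp. 27–28, Step (viii) p. 29 (the constant of the display); Cor. 2.2 (ii) proof (P1)–(P7) pp. 44–46. Dupuy–Hilado
[DupuyHilado2025] §3.3, §3.6, §4.7, §4.12 (the (U)-reading hull of the union of the (Ind1)(Ind2)-images).

THE CONE BINDER of the (U)-line certificates is `hvol : ∀ P ∈ UP, ∀ l prime ≥ 5, AdmitsCore → CondP2 → CondP5 → CondP6 →
Cor22.HullVolumeAtDatum P l B_III(P,l)` (`Conditional.abc_of_S_v3`, p430884) or its regime form `hreg` (v4/v6K/v7K/v8K-window/v9K-window/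
v10M/v11M-window/p443000; `hreg ⟹ hvol` = abc-iut-c312-8's `ThetaPartII.hullVolume_of_hullRegime`), `B_III(P,l) = (l+1)/4·{(1+12d_mod/l)(lD+lC) + E(l)}`,
`E(l) = 2 log l + 52 + (20/3)·log(d*l)·π(d*l)`, `lD = log-diff(λ)`, `lC = log 𝔣^{F_tpd}_{∤2l}(λ)`, `d* = 2¹²·3³·5·d_mod`.

THIS FILE (bricks cited BY NAME; nothing re-typed):
* **`exists_windowPrime_quadWitness`** — at abc-iut-s2-p5's admissible degree-2 family `P_k = (ℚ(√2), λ_k = 1/2 + 2/(3+√2)^k)`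
  (p441759/p442698: `P_k ∈ UP ∩ K_V`, `d_mod = 2`, admits a core, the MIXED prime `7 = 𝔭𝔭'` with `ord_𝔭 j(λ_k) ≤ −2k`, `ord_{𝔭'} j(λ_k) = 0`),
  for all large `k`, abc-iut-s2-p3's WINDOW prime (`Cor22Window.exists_admissible_prime_window`, p443605: `l ≥ 11`, `l ≠ 7`, (P2)/(P5)/(P6)
  PROVED by the tree's effective (P1)–(P3) choice and (P4) ⟹ (P6), `√h ≤ l ≤ 10δ₂√h·log(2δ₂h)`), with, for EVERY `δ`,
  `Cor22.HullVolumeAtDatum P_k l δ ⟹ (l+1)·k·log 7/48 ≤ δ − ((l+5)/4 − 2)·(lD + (1−1/l)·lC)` — abc-iut-S4's log-different slack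
  (`PointDict.pair_le_slack_of_hullVolumeAtDatum`, p445514) transported to the presenting field (part 1, `Conditional/HvolSharpSplitDepth`,
  `PointDict.splitDepth_le_slack_of_hullVolumeAtDatum`, p450810);
* `logCondAvoid_quadWitness_le` — `lC ≤ log-cond(λ_k) ≤ 3·ht(λ_k) + log 2 ≤ A' + B'·k` (`Cor22.logCondAvoid_le_logCond`, [GenEll] Prop. 1.6
  `NFPoint.logCond_le`, Mathlib Weil-height arithmetic as in abc-iut-s2-p3's `logQForall_quadWitness_le`); `logDiff_quadWitness_eq` (`lD` is `k`-free);
* three elementary real-analysis lines: `slackRHS_le` (`B_III − gain ≤ 8(lD+lC) + (l+1)/4·E(l)` at `l ≥ 11`), `exists_nat_forall_sqrt_mul_log_le`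
  (`M√y·log(cy) + 13 ≤ εk` for `y ≤ Dk`, all large `k`), `endgame` (the final contradiction shape).
READING: consequences of the typed (U)-computable half at genuine data; nothing asserted about `HullVolumeAtDatum` or about any point
beyond the family's proved arithmetic; refuted-as-typed ≠ refuted-in-print; no side taken. PROOF-ONLY file: no definitions, no `Prop` facts.
[cite: Mochizuki2012, IUTchIV Thm. 1.10 Step (ii) p. 24, Step (v) p. 27–28, Step (viii) p. 29]
[cite: Mochizuki2012, IUTchIV Cor. 2.2 (ii) proof (P1)–(P7) p. 44–46] [cite: MochizukiGenEll2010, Prop 1.6 p.9; Ex 1.3 (ii) p.5]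
[cite: DupuyHilado2025, §3.3, §3.6, §4.7, §4.11–4.12] [claim: Mochizuki2012, status: disputed] for every IUT quotation.
-/

noncomputable section

namespace Summit.ABC.IUTFork

open NumberField IsDedekindDomain Literature.IUT.LogVolume Literature.IUT.HodgeTheaters
open Literature.NumberTheory.DiophantineGeometry.GenEll
open scoped Classical

namespace Conditional

open PointDict

/-! ## §1. The admissible degree-2 family with its (P1)-window prime, and the SHARP necessity there -/

/-- **THE ADMISSIBLE DEGREE-2 FAMILY WITH A WINDOW PRIME, and what the (U)-computable half asserts there — SHARP FORM.**
There is `k₀` such that for every `k ≥ k₀` the point `P_k = (ℚ(√2), 1/2 + 2/(3+√2)^k)` (abc-iut-s2-p5: `P_k ∈ UP ∩ K_V`, `d_mod = 2`,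
admitting a core) carries a prime `l ≥ 11`, `l ≠ 7`, with (P2), (P5), (P6) PROVED (abc-iut-s2-p3's `Cor22Window.exists_admissible_prime_window`:
the tree's effective (P1)–(P3) choice and (P4) ⟹ (P6)), inside `√h_k ≤ l ≤ 10δ₂·√h_k·log(2δ₂h_k)` (`h_k = log(q^∀(λ_k)) ≥ log(q^{∤{2,l}}(λ_k)) ≥
k·log 2`), at which, for EVERY `δ`: `Cor22.HullVolumeAtDatum P_k l δ` forces
`(l+1)·k·log 7/48 ≤ δ − ((l+5)/4 − 2)·(log-diff(P_k) + (1 − 1/l)·log 𝔣^{∤{2,l}}(λ_k))` (part 1's `splitDepth_le_slack_of_hullVolumeAtDatum` on the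
genuine datum of abc-iut-L5-t7's `ThetaPartII.stub_thetaData`; abc-iut-S4's log-different gain). Every hypothesis of [IUTchIV] Cor. 2.2 (ii)
at `(P_k, l)` is a theorem; nothing is asserted about `HullVolumeAtDatum`; no side taken.
[cite: Mochizuki2012, IUTchIV Cor. 2.2 (ii) proof (P1)–(P7) p. 44–46] [cite: Mochizuki2012, IUTchIV Thm. 1.10 Step (ii) p. 24, Step (v) p. 27–28]
[claim: Mochizuki2012, status: disputed] -/
theorem exists_windowPrime_quadWitness :
    ∃ k₀ : ℕ, ∀ k : ℕ, k₀ ≤ k →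
      QuadWitness.P k ∈ UP ∧ Cor22.AdmitsCore (QuadWitness.P k) ∧ Cor22.dmod (QuadWitness.P k) = 2 ∧
      ∃ l : ℕ, l.Prime ∧ 11 ≤ l ∧ l ≠ 7 ∧ Cor22.CondP2 (QuadWitness.P k) l ∧ Cor22.CondP5 (QuadWitness.P k) l ∧
        Cor22.CondP6 (QuadWitness.P k) l ∧
        Real.sqrt (Cor22.logQForall (QuadWitness.P k)) ≤ l ∧
        (l : ℝ) ≤ 10 * Cor22.delta 2 * Real.sqrt (Cor22.logQForall (QuadWitness.P k)) *
          Real.log (2 * Cor22.delta 2 * Cor22.logQForall (QuadWitness.P k)) ∧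
        (k : ℝ) * Real.log 2 ≤ Cor22.logQAvoid (QuadWitness.P k) {2, l} ∧
        (k : ℝ) * Real.log 2 ≤ Cor22.logQForall (QuadWitness.P k) ∧
        ∀ δ : ℝ, Cor22.HullVolumeAtDatum (QuadWitness.P k) l δ →
          ((l : ℝ) + 1) * k * Real.log 7 / 48 ≤
            δ - (((l : ℝ) + 5) / 4 - 2) *
              ((QuadWitness.P k).logDiff + (1 - 1 / (l : ℝ)) * Cor22.logCondAvoid (QuadWitness.P k) {2, l}) := by
  -- adapted from abc-iut-s2-p3's `splitDepth_window_of_hvol` / `splitDepthWindow_quadWitness_of_hvol`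
  -- (Conditional/AbcOfSHvolAdmissibleWindow.lean); the last step is part 1's SHARP `splitDepth_le_slack_of_hullVolumeAtDatum`
  haveI h7p : Fact (Nat.Prime 7) := ⟨by norm_num⟩
  obtain ⟨𝔭, 𝔭', ha, habar, ha', -, h7, h7'⟩ := QuadWitness.exists_places
  obtain ⟨H₀, hH₀⟩ := Cor22Window.exists_admissible_prime_window (CBData.std {2} QuadWitness.hS2) 2
  have hlog2 : 0 < Real.log 2 := Real.log_pos (by norm_num)
  -- the two places over `7` as elements of `V(F)_7`
  let v₀ : placesOver QuadWitness.F 7 := ⟨𝔭, Cor22.mem_placesOver_of_natCast_mem 7 𝔭 h7⟩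
  let w : placesOver QuadWitness.F 7 := ⟨𝔭', Cor22.mem_placesOver_of_natCast_mem 7 𝔭' h7'⟩
  have hvw : w ≠ v₀ := by
    intro h
    have : 𝔭' = 𝔭 := congrArg Subtype.val h
    exact ha' (this ▸ ha)
  -- `k₀`: `k·log 2 > max(H₀, 49)` and `k ≥ 6`
  refine ⟨max 71 (⌈H₀ / Real.log 2⌉₊ + 1), fun k hk => ?_⟩
  have hk71 : 71 ≤ k := (le_max_left _ _).trans hk
  have hk6 : 6 ≤ k := by omega
  have hk1 : 1 ≤ k := by omega
  have hkH : H₀ < (k : ℝ) * Real.log 2 := by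
    have h1 : H₀ / Real.log 2 ≤ ⌈H₀ / Real.log 2⌉₊ := Nat.le_ceil _
    have h2 : ((⌈H₀ / Real.log 2⌉₊ + 1 : ℕ) : ℝ) ≤ (k : ℝ) := by exact_mod_cast (le_max_right _ _).trans hk
    push_cast at h2
    rw [div_le_iff₀ hlog2] at h1
    nlinarith
  have hlogQ3 : (k : ℝ) * Real.log 2 ≤ Cor22.logQAvoid (QuadWitness.P k) {2, 3} :=
    QuadWitness.le_logQAvoid_P ha h7 hk1 Nat.prime_three (by norm_num)
  have hlogQ : (k : ℝ) * Real.log 2 ≤ Cor22.logQForall (QuadWitness.P k) :=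
    hlogQ3.trans (Cor22.logQAvoid_anti (QuadWitness.P k) (Finset.empty_subset _))
  have hH : H₀ < Cor22.logQForall (QuadWitness.P k) := hkH.trans_le hlogQ
  have h49 : (49 : ℝ) < Cor22.logQForall (QuadWitness.P k) := by
    have h71 : (71 : ℝ) ≤ k := by exact_mod_cast hk71
    have := Real.log_two_gt_d9
    nlinarith
  have hp : ((7 : ℕ) : ℝ) < Real.sqrt (Cor22.logQForall (QuadWitness.P k)) := by
    rw [show ((7 : ℕ) : ℝ) = Real.sqrt (7 ^ 2) by rw [Real.sqrt_sq (by norm_num)]; norm_num]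
    exact Real.sqrt_lt_sqrt (by norm_num) (by norm_num; exact h49)
  obtain ⟨htop, hd⟩ := quadWitness_adjoin_jInv_eq_top ha habar ha' h7 h7' hk1
  have hjv : ord QuadWitness.F v₀.1 (Cor22.jInv (QuadWitness.lam k)) ≤ -(2 * k : ℤ) :=
    QuadWitness.ord_jInv_lam_le ha h7 hk1
  have hjw : 0 ≤ ord QuadWitness.F w.1 (Cor22.jInv (QuadWitness.lam k)) :=
    (QuadWitness.ord_at_good h7' habar ha' k).2.ge
  have hUP : QuadWitness.P k ∈ UP := QuadWitness.P_mem_UP ha habar ha' h7 h7' hk6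
  have hmem := QuadWitness.P_mem_std hk6
  have hcore : Cor22.AdmitsCore (QuadWitness.P k) := QuadWitness.admitsCore_P ha h7 hk1
  have hdeg : (QuadWitness.P k).degree ≤ 2 := by
    change Module.finrank ℚ QuadWitness.F ≤ 2
    rw [QuadWitness.finrank_F]
  have hneg : ord QuadWitness.F v₀.1 (Cor22.jInv (QuadWitness.lam k)) < 0 := by
    have : (1 : ℤ) ≤ k := by exact_mod_cast hk1
    omega
  -- the WINDOW prime with (P2), (P5), (P6) PROVED
  obtain ⟨l, hlp, hl7, hlp', hP2, hP5, hP6, hlo, hhi⟩ :=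
    hH₀ (QuadWitness.P k) hUP hmem hdeg v₀ (by norm_num) hneg hH hp
  have hl11 : 11 ≤ l := by
    rcases Nat.lt_or_ge l 11 with hlt | hge
    · interval_cases l <;> simp_all (config := {decide := true})
    · exact hge
  have hlogQl : (k : ℝ) * Real.log 2 ≤ Cor22.logQAvoid (QuadWitness.P k) {2, l} :=
    QuadWitness.le_logQAvoid_P ha h7 hk1 hlp hlp'
  refine ⟨hUP, hcore, hd, l, hlp, hl11, hlp', hP2, hP5, hP6, hlo, hhi, hlogQl, hlogQ, fun δ h => ?_⟩
  -- the genuine datum and the SHARP split-depth inequality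
  obtain ⟨T⟩ := Summit.ABC.ABC.Theorems.ThetaPartII.stub_thetaData _ hUP l hlp (by omega) hcore hP2 hP5 hP6
  have h2 : ((2 : ℕ) : 𝓞 QuadWitness.F) ∉ v₀.1.asIdeal :=
    SplitDepth.natCast_not_mem_of_prime_ne v₀ Nat.prime_two (by norm_num)
  have hl : ((l : ℕ) : 𝓞 QuadWitness.F) ∉ v₀.1.asIdeal := SplitDepth.natCast_not_mem_of_prime_ne v₀ hlp hlp'
  obtain ⟨hn1, -⟩ := SplitDepth.localDegree_eq_one QuadWitness.finrank_F v₀ w hvw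
  obtain ⟨hwt1, hlog⟩ := SplitDepth.weight_eq_half_and_logNorm_eq QuadWitness.finrank_F v₀ w hvw
  obtain ⟨hwt2, -⟩ := SplitDepth.weight_eq_half_and_logNorm_eq QuadWitness.finrank_F w v₀ (Ne.symm hvw)
  have hineq := splitDepth_le_slack_of_hullVolumeAtDatum h T (by omega) htop hd v₀.2 w.2 hk1 hjv hjw h2 hl hwt1 hwt2 hn1 hlog
  have h7log : Real.log ((7 : ℕ) : ℝ) = Real.log 7 := by norm_num
  rw [h7log] at hineq
  exact hineq

/-! ## §2. Bookkeeping: the conductor of the family is linear in `k`; a real-analysis line -/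

/-- **`log 𝔣^{∤S}(λ_k) ≤ A' + B'·k`** for the family `λ_k = 1/2 + 2/(3+√2)^k`: `log-cond^{∤S} ≤ log-cond ≤ 3·ht + log 2`
(`Cor22.logCondAvoid_le_logCond`, [GenEll] Prop. 1.6 `NFPoint.logCond_le`) and `ht(λ_k) = (1/2)·h(λ_k) ≤ (W + 2·h(2) + k·h(3+√2))/2`
(Mathlib `Height.logHeight₁_add_le/_mul_le/_inv/_pow`). [cite: MochizukiGenEll2010, Prop 1.6 p.9] -/
theorem logCondAvoid_quadWitness_le :
    ∃ A' B' : ℝ, 0 ≤ A' ∧ 0 ≤ B' ∧ ∀ k : ℕ, (QuadWitness.P k).InU → ∀ S : Finset ℕ,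
      Cor22.logCondAvoid (QuadWitness.P k) S ≤ A' + B' * k := by
  set W : ℝ := (Height.totalWeight QuadWitness.F : ℝ) * Real.log 2 with hW
  set h2 : ℝ := Height.logHeight₁ (2 : QuadWitness.F) with hh2
  set ha : ℝ := Height.logHeight₁ ((QuadWitness.a : 𝓞 QuadWitness.F) : QuadWitness.F) with hha
  have hnn : ∀ y : QuadWitness.F, 0 ≤ Height.logHeight₁ y := fun y => by
    rw [Height.logHeight₁_eq_log_mulHeight₁]; exact Real.log_nonneg (Height.one_le_mulHeight₁ _)
  have hW0 : 0 ≤ W := by positivity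
  have h20 : 0 ≤ h2 := hnn _
  have ha0 : 0 ≤ ha := hnn _
  have hlog2 : 0 ≤ Real.log 2 := Real.log_nonneg (by norm_num)
  -- `h(λ_k) ≤ W + 2·h(2) + k·h(a)` (as in abc-iut-s2-p3's `logQForall_quadWitness_le`)
  have hlam : ∀ k : ℕ, Height.logHeight₁ (QuadWitness.lam k) ≤ W + 2 * h2 + k * ha := by
    intro k
    have h1 : Height.logHeight₁ (QuadWitness.lam k) ≤
        W + Height.logHeight₁ ((2 : QuadWitness.F)⁻¹) +
          Height.logHeight₁ (2 / ((QuadWitness.a : 𝓞 QuadWitness.F) : QuadWitness.F) ^ k) :=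
      Height.logHeight₁_add_le _ _
    have h2' : Height.logHeight₁ ((2 : QuadWitness.F)⁻¹) = h2 := Height.logHeight₁_inv _
    have h3 : Height.logHeight₁ (2 / ((QuadWitness.a : 𝓞 QuadWitness.F) : QuadWitness.F) ^ k) ≤ h2 + k * ha := by
      rw [div_eq_mul_inv]
      refine (Height.logHeight₁_mul_le _ _).trans ?_
      rw [Height.logHeight₁_inv, Height.logHeight₁_pow]
    linarith
  refine ⟨3 / 2 * (W + 2 * h2) + Real.log 2, 3 / 2 * ha, by positivity, by positivity, fun k hU S => ?_⟩
  have hdeg : ((QuadWitness.P k).degree : ℝ) = 2 := by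
    change ((Module.finrank ℚ QuadWitness.F : ℕ) : ℝ) = 2
    rw [QuadWitness.finrank_F]; norm_num
  have h1 := Cor22.logCondAvoid_le_logCond (QuadWitness.P k) hU S
  have h2'' := NFPoint.logCond_le (QuadWitness.P k) hU
  have h3 : (QuadWitness.P k).ht = 2⁻¹ * Height.logHeight₁ (QuadWitness.lam k) := by
    unfold NFPoint.ht
    rw [hdeg]
  rw [h3] at h2''
  have h4 := hlam k
  nlinarith

/-- **`log-diff(P_k)` does not depend on `k`**: the family is presented over the fixed field `ℚ(√2)`, and
`log-diff = [F:ℚ]⁻¹·log N(𝔡_F)`. [cite: MochizukiGenEll2010, Def 1.5 (iii) p.8] -/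
theorem logDiff_quadWitness_eq (k : ℕ) : (QuadWitness.P k).logDiff = (QuadWitness.P 0).logDiff := by
  unfold NFPoint.logDiff NFPoint.degree
  rfl

/-! ### Elementary real-analysis lines (the growth comparison of Cor. 2.2 (ii), (P1): `l·log l = O(h^{1/2}·log² h)` against the depth `k ≍ h`) -/

/-- The slack of [IUTchIV] Thm. 1.10's constant after abc-iut-S4's log-different gain, at `d_mod = 2`, `l ≥ 11`:
`(L+1)/4·{(1+24/L)(lD+lC) + E} − ((L+5)/4 − 2)·(lD + (1−1/L)·lC) ≤ 8·(lD+lC) + (L+1)/4·E`. Elementary real arithmetic.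
[cite: Mochizuki2012, IUTchIV Thm. 1.10 Step (viii) p. 29] -/
theorem slackRHS_le {L lD lC e₁ e₂ e₃ : ℝ} (hL : 11 ≤ L) (hlD : 0 ≤ lD) (hlC : 0 ≤ lC) :
    (L + 1) / 4 * ((1 + 24 / L) * (lD + lC) + e₁ + e₂ + e₃) - ((L + 5) / 4 - 2) * (lD + (1 - 1 / L) * lC) ≤
      8 * (lD + lC) + (L + 1) / 4 * (e₁ + e₂ + e₃) := by
  have hL0 : L ≠ 0 := by intro h; rw [h] at hL; norm_num at hL
  have hLpos : 0 < L := by linarith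
  have eq : (L + 1) / 4 * ((1 + 24 / L) * (lD + lC) + e₁ + e₂ + e₃) - ((L + 5) / 4 - 2) * (lD + (1 - 1 / L) * lC) =
      (lD * (28 * L + 24) + lC * (29 * L + 21)) / (4 * L) + (L + 1) / 4 * (e₁ + e₂ + e₃) := by
    field_simp
    ring
  rw [eq]
  have hfrac : (lD * (28 * L + 24) + lC * (29 * L + 21)) / (4 * L) ≤ 8 * (lD + lC) := by
    rw [div_le_iff₀ (by positivity)]
    nlinarith [mul_nonneg hlD (by linarith : (0 : ℝ) ≤ L - 6), mul_nonneg hlC (by linarith : (0 : ℝ) ≤ L - 7)]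
  linarith

/-- `log t ≤ 4·√(√t)` for `t > 0` (`log s ≤ s − 1` at `s = t^{1/4}`). [folklore] -/
theorem log_le_four_mul_sqrt_sqrt {t : ℝ} (ht : 0 < t) : Real.log t ≤ 4 * Real.sqrt (Real.sqrt t) := by
  have hs : 0 < Real.sqrt t := Real.sqrt_pos.mpr ht
  have hss : 0 < Real.sqrt (Real.sqrt t) := Real.sqrt_pos.mpr hs
  have h1 : Real.log (Real.sqrt (Real.sqrt t)) ≤ Real.sqrt (Real.sqrt t) - 1 := Real.log_le_sub_one_of_pos hss
  rw [Real.log_sqrt hs.le, Real.log_sqrt ht.le] at h1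
  linarith

/-- **`M·(√y·log(c·y)) + 13 ≤ ε·k` for `1 ≤ y ≤ D·k`, all large `k`** (`M ≥ 0`, `c ≥ 1`, `D ≥ 1`, `ε > 0`): `log(cy) ≤ 4·(cy)^{1/4}`,
so the left side is `≤ 4M·D^{1/2}(cD)^{1/4}·k^{3/4} + 13`. Elementary. [cite: Mochizuki2012, IUTchIV Cor. 2.2 (ii) proof (P1) p. 44–45] -/
theorem exists_nat_forall_sqrt_mul_log_le (M c D ε : ℝ) (hM : 0 ≤ M) (hc : 1 ≤ c) (hD : 1 ≤ D) (hε : 0 < ε) :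
    ∃ k₁ : ℕ, ∀ k : ℕ, k₁ ≤ k → ∀ y : ℝ, 1 ≤ y → y ≤ D * k →
      M * (Real.sqrt y * Real.log (c * y)) + 13 ≤ ε * k := by
  -- the constant `K = 4M·√D·√√(cD)`
  obtain ⟨K, hK⟩ : ∃ K : ℝ, K = 4 * M * Real.sqrt D * Real.sqrt (Real.sqrt (c * D)) := ⟨_, rfl⟩
  have hK0 : 0 ≤ K := by rw [hK]; positivity
  obtain ⟨k₁, hk₁⟩ := exists_nat_ge ((2 * K / ε) ^ 4 + 26 / ε + 1)
  refine ⟨k₁, fun k hk y hy1 hyD => ?_⟩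
  have hkR : (2 * K / ε) ^ 4 + 26 / ε + 1 ≤ k := hk₁.trans (by exact_mod_cast hk)
  have h4nn : 0 ≤ (2 * K / ε) ^ 4 := by positivity
  have h26 : 0 ≤ 26 / ε := by positivity
  have hk4 : (2 * K / ε) ^ 4 ≤ k := by linarith
  have hk26 : 26 / ε ≤ k := by linarith
  have hkpos : (0 : ℝ) < k := by linarith
  have hy0 : 0 < y := by linarith
  have hc0 : 0 < c := by linarith
  have hcy : 0 < c * y := mul_pos hc0 hy0
  -- `log(cy) ≤ 4 √√(cy) ≤ 4 √√(cDk)`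
  have h1 : Real.log (c * y) ≤ 4 * Real.sqrt (Real.sqrt (c * y)) := log_le_four_mul_sqrt_sqrt hcy
  have hcyD : c * y ≤ c * D * k := by
    have := mul_le_mul_of_nonneg_left hyD hc0.le
    linarith [this]
  have h2 : Real.sqrt (Real.sqrt (c * y)) ≤ Real.sqrt (Real.sqrt (c * D * k)) :=
    Real.sqrt_le_sqrt (Real.sqrt_le_sqrt hcyD)
  have h3 : Real.sqrt y ≤ Real.sqrt (D * k) := Real.sqrt_le_sqrt hyD
  -- `√(Dk) = √D·√k`, `√√(cDk) = √√(cD)·√√k`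
  have hD0 : 0 ≤ D := by linarith
  have hcD0 : 0 ≤ c * D := by positivity
  have e1 : Real.sqrt (D * k) = Real.sqrt D * Real.sqrt k := Real.sqrt_mul hD0 _
  have e2 : Real.sqrt (Real.sqrt (c * D * k)) = Real.sqrt (Real.sqrt (c * D)) * Real.sqrt (Real.sqrt k) := by
    rw [Real.sqrt_mul hcD0, Real.sqrt_mul (Real.sqrt_nonneg _)]
  have hsy : 0 ≤ Real.sqrt y := Real.sqrt_nonneg _
  have hmain : M * (Real.sqrt y * Real.log (c * y)) ≤ K * Real.sqrt k * Real.sqrt (Real.sqrt k) := by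
    have ha : Real.sqrt y * Real.log (c * y) ≤ Real.sqrt y * (4 * Real.sqrt (Real.sqrt (c * y))) :=
      mul_le_mul_of_nonneg_left h1 hsy
    have hb : Real.sqrt y * (4 * Real.sqrt (Real.sqrt (c * y))) ≤
        Real.sqrt (D * k) * (4 * Real.sqrt (Real.sqrt (c * D * k))) :=
      mul_le_mul h3 (by linarith) (by positivity) (Real.sqrt_nonneg _)
    have hc' : M * (Real.sqrt y * Real.log (c * y)) ≤ M * (Real.sqrt (D * k) * (4 * Real.sqrt (Real.sqrt (c * D * k)))) :=
      mul_le_mul_of_nonneg_left (ha.trans hb) hM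
    have e3 : M * (Real.sqrt (D * k) * (4 * Real.sqrt (Real.sqrt (c * D * k)))) = K * Real.sqrt k * Real.sqrt (Real.sqrt k) := by
      rw [e1, e2, hK]; ring
    linarith [hc', e3.le]
  -- `K·√k·√√k ≤ (ε/2)·k` since `√√k ≥ 2K/ε`, and `13 ≤ (ε/2)·k`
  have hsk : Real.sqrt k * Real.sqrt k = k := Real.mul_self_sqrt hkpos.le
  have hssk : Real.sqrt (Real.sqrt k) * Real.sqrt (Real.sqrt k) = Real.sqrt k := Real.mul_self_sqrt (Real.sqrt_nonneg _)
  have hKε : 0 ≤ 2 * K / ε := by positivity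
  have hroot : 2 * K / ε ≤ Real.sqrt (Real.sqrt k) := by
    have h4 : ((2 * K / ε) ^ 2) ^ 2 ≤ k := by
      have e : ((2 * K / ε) ^ 2) ^ 2 = (2 * K / ε) ^ 4 := by ring
      rw [e]; exact hk4
    have h5 : (2 * K / ε) ^ 2 ≤ Real.sqrt k := by
      have := Real.sqrt_le_sqrt h4
      rwa [Real.sqrt_sq (by positivity)] at this
    have := Real.sqrt_le_sqrt h5
    rwa [Real.sqrt_sq hKε] at this
  have hA : K * Real.sqrt k * Real.sqrt (Real.sqrt k) ≤ ε / 2 * k := by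
    have hs0 : 0 ≤ Real.sqrt k := Real.sqrt_nonneg _
    have hss0 : 0 ≤ Real.sqrt (Real.sqrt k) := Real.sqrt_nonneg _
    have hK' : K ≤ ε / 2 * Real.sqrt (Real.sqrt k) := by
      have := mul_le_mul_of_nonneg_left hroot (by positivity : (0 : ℝ) ≤ ε / 2)
      have e : ε / 2 * (2 * K / ε) = K := by field_simp
      linarith [this, e.le, e.ge]
    calc K * Real.sqrt k * Real.sqrt (Real.sqrt k)
        ≤ (ε / 2 * Real.sqrt (Real.sqrt k)) * Real.sqrt k * Real.sqrt (Real.sqrt k) :=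
          mul_le_mul_of_nonneg_right (mul_le_mul_of_nonneg_right hK' hs0) hss0
      _ = ε / 2 * (Real.sqrt (Real.sqrt k) * Real.sqrt (Real.sqrt k)) * Real.sqrt k := by ring
      _ = ε / 2 * k := by rw [hssk, mul_assoc, hsk]
  have hB : (13 : ℝ) ≤ ε / 2 * k := by
    have := mul_le_mul_of_nonneg_left hk26 hε.le
    have e : ε * (26 / ε) = 26 := by field_simp
    linarith [this, e.le, e.ge]
  linarith

/-- **The endgame** (elementary real arithmetic): the SHARP necessity `S·K·c/48 ≤ 8(lD+lC) + S/4·E` at the family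
(`S = l+1`, `K = k`, `c = log 7`), the error bound `E ≤ T`, `T/4 ≤ K·c/96`, the conductor bound `lC ≤ A' + B'·K`, and the size of the
window prime `r = √(K·log 2) ≤ S` are contradictory once `K ≥ (96·(8(lD+A') + 8B')/c)²/log 2 + 1`.
[cite: Mochizuki2012, IUTchIV Cor. 2.2 (ii) proof (P1) p. 44–45] -/
theorem endgame {S K c lD lC A' B' E T r L₂ : ℝ}
    (hc : 0 < c) (hK1 : 1 ≤ K) (hlD : 0 ≤ lD) (hA' : 0 ≤ A') (hB' : 0 ≤ B') (hL₂ : 0 < L₂)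
    (h1 : S * K * c / 48 ≤ 8 * (lD + lC) + S / 4 * E) (h2 : E ≤ T) (h3 : T / 4 ≤ K * c / 96)
    (h5 : lC ≤ A' + B' * K) (hr0 : 0 ≤ r) (hr : r ≤ S) (hrK : r ^ 2 = K * L₂)
    (hbig : (96 * (8 * (lD + A') + 8 * B') / c) ^ 2 / L₂ + 1 ≤ K) : False := by
  have hK : 0 < K := by linarith
  have hS : 0 ≤ S := hr0.trans hr
  -- `S/4·E ≤ S·K·c/96`
  have h4 : S / 4 * E ≤ S * K * c / 96 := by
    have hT : S / 4 * E ≤ S / 4 * T := mul_le_mul_of_nonneg_left h2 (by positivity)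
    have hT' : S / 4 * T ≤ S * (K * c / 96) := by
      have := mul_le_mul_of_nonneg_left h3 hS
      have e : S / 4 * T = S * (T / 4) := by ring
      rw [e]; exact this
    have e2 : S * (K * c / 96) = S * K * c / 96 := by ring
    linarith [hT, hT', e2.le, e2.ge]
  obtain ⟨Q, hQ⟩ : ∃ Q : ℝ, Q = 8 * (lD + A') + 8 * B' := ⟨_, rfl⟩
  have hQ0 : 0 ≤ Q := by rw [hQ]; positivity
  -- `S·K·c/96 ≤ Q·K`
  have h6 : S * K * c / 96 ≤ Q * K := by
    have h8 : 8 * (lD + A') ≤ 8 * (lD + A') * K := by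
      have := mul_le_mul_of_nonneg_left hK1 (by positivity : (0 : ℝ) ≤ 8 * (lD + A'))
      linarith [this]
    have h9 : S * K * c / 96 ≤ 8 * (lD + A') + 8 * (B' * K) := by linarith [h1, h4, h5]
    have e : Q * K = 8 * (lD + A') * K + 8 * (B' * K) := by rw [hQ]; ring
    linarith [h9, h8, e.le, e.ge]
  -- `r·c/96 ≤ Q`
  have h7 : r * (K * c / 96) ≤ Q * K := by
    have := mul_le_mul_of_nonneg_right hr (by positivity : (0 : ℝ) ≤ K * c / 96)
    have e : S * (K * c / 96) = S * K * c / 96 := by ring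
    linarith [this, h6, e.le, e.ge]
  have h8 : r * c / 96 ≤ Q := by
    have e : r * (K * c / 96) = (r * c / 96) * K := by ring
    rw [e] at h7
    exact le_of_mul_le_mul_right h7 hK
  have h9 : r ≤ 96 * Q / c := by
    rw [le_div_iff₀ hc]
    linarith
  have h10 : K * L₂ ≤ (96 * Q / c) ^ 2 := by
    rw [← hrK]
    exact pow_le_pow_left₀ hr0 h9 2
  have h11 : K ≤ (96 * Q / c) ^ 2 / L₂ := by
    rw [le_div_iff₀ hL₂]
    exact h10
  rw [hQ] at h11
  linarith
end Conditional

end Summit.ABC.IUTFork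

end
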